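import Summits.ValiantsHypothesis.ValiantsHypothesis.Theorems.BarrierLeverChowHitsPartitionMinorsRStarvedPairs

/-!
# Route BarrierLever — item `ChowHitsPartitionMinorsR` (stmt-ValiantsHypothesis-21882):
# THE KILLER LAYOUT BY NAME — the starved pairs of p722854 as named definitions; they ARE `IsStarvedPair`,
# so they are dead for `n + n` forms and hit by `n + C(o,2)` explicit forms

Helper file (`--supports stmt-ValiantsHypothesis-21882`; cell valiant-natproofs, rung V4, 𝒟-side; prover seat val-np-p5
gen 32; planner RULING R69(a)/(c), STATUS l.1926). Closes NO item.

WHY. `ChowStarvedPairs.exists_starvedPair` (p722854) hides its layout behind an existential. This file NAMES it —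
height `n = 2o+1`; rows `starvedU o` = all subsets of `Fin n` of size `≤ 2`; columns `starvedW o` = the same sets except
that each pair inside the block `O = {o+1, …, 2o}` is replaced by the triple `{c − (o+1), c' − (o+1), o}` — and proves, BY
NAME: both families are injective LOWER SETS of equal size, both THICK; for `o ≥ 12` NO product of `n + n` affine forms hits
the layout (`starved_dead`, via `ChowStarve.no_chow_witness`); and the layout IS a starved pair in the sense of the device
`ChowStarvedDesign.IsStarvedPair` (`isStarvedPair_starved`: block `starvedO o`, matching `j ↦ (min, max)` of the row `u j`,
which for a 3-column `j` is exactly the replaced pair). CONSEQUENCES (kernel): the killers are hit by `n + C(o,2)` explicit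
forms (`starved_hit`, THEOREM A′ `chowHits_of_starved` with `#(3-columns) ≤ C(|O|,2) = C(o,2)`), so for these pairs the
truth lies strictly between the refuted budget `2n` and `n + C(o,2) ≈ n²/8 + n`; and the non-vacuity witnesses of the
registry-v3a node (`ChowStarvedPairs.noBiStar_node_nonvacuous`) are ALL excluded by the v4 narrowing «¬ IsStarvedPair»
(`noBiStar_witnesses_starved`): the v4 node `ChowNoStar.Stmt.stub_thickLowerSetsChowRNoStarved` has no member known by name.
THIS FILE: the layout (§1), rows (§2), the column map (§3), thickness (§4), deadness (§5). The companion file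
`…ChowHitsPartitionMinorsRStarvedKillersHit` proves `isStarvedPair_starved`, `starved_hit`, `noBiStar_witnesses_starved`.

WHAT THIS IS NOT: item 21882 is NOT proved and the v4 nodes remain OPEN (unknown members may exist: crossing non-column
pairs, rows of dimension 3, …); nothing on crux stmt-ValiantsHypothesis-14610 or on `VP` versus `VNP`.
-/

set_option linter.dupNamespace false

namespace Summit.ValiantsHypothesis.ValiantsHypothesis.Theorems.BarrierLever.ChowStarvedPairs

open Finset MvPolynomial
open Summit.ValiantsHypothesis.ValiantsHypothesis.Theorems.BarrierLever.ChowStarve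
  (no_chow_witness three_mul_lt_choose)

noncomputable section

variable (o : ℕ)

/-! ## 1. The layout -/

/-- The thin sets: all subsets of `Fin (2o+1)` of size `≤ 2`. -/
def thinSets : Finset (Finset (Fin (2 * o + 1))) := Finset.univ.filter fun U => U.card ≤ 2

/-- The common number of rows and columns, `1 + n + C(n,2)`. -/
def starvedSize : ℕ := (thinSets o).card

/-- **Rows**: an enumeration of all subsets of size `≤ 2`. -/
def starvedU (i : Fin (starvedSize o)) : Finset (Fin (2 * o + 1)) := ((thinSets o).equivFin.symm i).1

/-- **The starved block** `O = {x : o < x} = {o+1, …, 2o}`. -/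
def starvedO : Finset (Fin (2 * o + 1)) := Finset.univ.filter fun x => o < (x : ℕ)

/-- The shift `x ↦ x − (o+1)` (sends `O` onto `{0, …, o−1}`). -/
def starvedShift (x : Fin (2 * o + 1)) : Fin (2 * o + 1) := ⟨(x : ℕ) - (o + 1), by omega⟩

/-- The apex `o` of the replacing triples. -/
def starvedApex : Fin (2 * o + 1) := ⟨o, by omega⟩

/-- A pair inside the block (reducible, so that it is decidable by unfolding). -/
abbrev IsOPair (U : Finset (Fin (2 * o + 1))) : Prop := U.card = 2 ∧ ∀ x ∈ U, o < (x : ℕ)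

/-- The column map: a pair `{c, c'}` inside `O` becomes the triple `{c − (o+1), c' − (o+1), o}`; other sets are kept. -/
def starvedCol (U : Finset (Fin (2 * o + 1))) : Finset (Fin (2 * o + 1)) :=
  if IsOPair o U then insert (starvedApex o) (U.image (starvedShift o)) else U

/-- **Columns**: the column map applied to the rows. -/
def starvedW (i : Fin (starvedSize o)) : Finset (Fin (2 * o + 1)) := starvedCol o (starvedU o i)

/-! ## 2. Rows -/

/-- Rows have size `≤ 2`. -/
theorem starvedU_card_le (i : Fin (starvedSize o)) : (starvedU o i).card ≤ 2 := by
  have h2 := ((thinSets o).equivFin.symm i).2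
  unfold thinSets at h2
  exact (Finset.mem_filter.mp h2).2

/-- The row enumeration is injective. -/
theorem starvedU_injective : Function.Injective (starvedU o) := fun _ _ hij =>
  (thinSets o).equivFin.symm.injective (Subtype.ext hij)

/-- Every set of size `≤ 2` is a row. -/
theorem starvedU_cover (U : Finset (Fin (2 * o + 1))) (hU : U.card ≤ 2) : ∃ i, starvedU o i = U :=
  ⟨(thinSets o).equivFin ⟨U, by unfold thinSets; exact Finset.mem_filter.mpr ⟨Finset.mem_univ _, hU⟩⟩, by
    simp only [starvedU, Equiv.symm_apply_apply]⟩

/-- The rows form a lower set. -/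
theorem isLowerSet_starvedU : IsLowerSet (Set.range (starvedU o)) := by
  rintro U V hVU ⟨i, rfl⟩
  exact starvedU_cover o V ((Finset.card_le_card hVU).trans (starvedU_card_le o i))

/-! ## 3. The column map -/

/-- Membership in the block. -/
theorem mem_starvedO {x : Fin (2 * o + 1)} : x ∈ starvedO o ↔ o < (x : ℕ) := by
  simp [starvedO]

/-- The replacing triples lie in `K = {x ≤ o}`. -/
theorem le_of_mem_triple (U : Finset (Fin (2 * o + 1))) :
    ∀ x ∈ insert (starvedApex o) (U.image (starvedShift o)), (x : ℕ) ≤ o := by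
  intro x hx
  rcases Finset.mem_insert.mp hx with rfl | hx
  · exact le_rfl
  · obtain ⟨y, -, rfl⟩ := Finset.mem_image.mp hx
    show (y : ℕ) - (o + 1) ≤ o
    have := y.is_lt
    omega

/-- The shift is injective on the block. -/
theorem shift_injOn (U : Finset (Fin (2 * o + 1))) (hU : ∀ x ∈ U, o < (x : ℕ)) :
    Set.InjOn (starvedShift o) U := by
  intro x hx y hy hxy
  have e1 := congrArg Fin.val hxy
  simp only [starvedShift] at e1
  have := hU x hx
  have := hU y hy
  exact Fin.ext (by omega)

/-- The replacing triple of a block pair has size `3`. -/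
theorem card_triple (U : Finset (Fin (2 * o + 1))) (hU : IsOPair o U) :
    (insert (starvedApex o) (U.image (starvedShift o))).card = 3 := by
  rw [Finset.card_insert_of_notMem, Finset.card_image_of_injOn (shift_injOn o U hU.2), hU.1]
  intro hmem
  obtain ⟨y, hy, hyo⟩ := Finset.mem_image.mp hmem
  have e1 := congrArg Fin.val hyo
  simp only [starvedShift, starvedApex] at e1
  have := hU.2 y hy
  have := y.is_lt
  omega

/-- The column map on block pairs. -/
theorem starvedCol_of_isOPair {U : Finset (Fin (2 * o + 1))} (hU : IsOPair o U) :
    starvedCol o U = insert (starvedApex o) (U.image (starvedShift o)) := if_pos hU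

/-- The column map fixes every other set. -/
theorem starvedCol_of_not {U : Finset (Fin (2 * o + 1))} (hU : ¬ IsOPair o U) : starvedCol o U = U := if_neg hU

/-- Block pairs become 3-columns. -/
theorem card_starvedCol_of_isOPair {U : Finset (Fin (2 * o + 1))} (hU : IsOPair o U) : (starvedCol o U).card = 3 := by
  rw [starvedCol_of_isOPair o hU, card_triple o U hU]

/-- A 3-column comes from a pair inside the block. -/
theorem isOPair_of_card_three (i : Fin (starvedSize o)) (h3 : (starvedW o i).card = 3) : IsOPair o (starvedU o i) := by
  by_contra hc
  unfold starvedW at h3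
  rw [starvedCol_of_not o hc] at h3
  have := starvedU_card_le o i
  omega

/-- Columns have size `≤ 3`. -/
theorem starvedW_card_le (j : Fin (starvedSize o)) : (starvedW o j).card ≤ 3 := by
  unfold starvedW
  by_cases hc : IsOPair o (starvedU o j)
  · rw [card_starvedCol_of_isOPair o hc]
  · rw [starvedCol_of_not o hc]
    exact (starvedU_card_le o j).trans (by norm_num)

/-- The column map does not decrease sizes. -/
theorem card_le_card_starvedW (j : Fin (starvedSize o)) : (starvedU o j).card ≤ (starvedW o j).card := by
  unfold starvedW
  by_cases hc : IsOPair o (starvedU o j)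
  · rw [card_starvedCol_of_isOPair o hc]; exact (starvedU_card_le o j).trans (by norm_num)
  · rw [starvedCol_of_not o hc]

/-- Elements of a 3-column lie in `K = {x ≤ o}`. -/
theorem le_of_mem_starvedW_three (j : Fin (starvedSize o)) (h3 : (starvedW o j).card = 3) :
    ∀ e ∈ starvedW o j, (e : ℕ) ≤ o := by
  have hc := isOPair_of_card_three o j h3
  unfold starvedW
  rw [starvedCol_of_isOPair o hc]
  exact le_of_mem_triple o _

/-- No column contains two elements of the block. -/
theorem starvedW_noOPair (j : Fin (starvedSize o)) :
    ∀ c ∈ starvedW o j, ∀ c' ∈ starvedW o j, c ≠ c' → (c : ℕ) ≤ o ∨ (c' : ℕ) ≤ o := by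
  intro c hc c' hc' hne
  by_cases hcond : IsOPair o (starvedU o j)
  · exact Or.inl (le_of_mem_starvedW_three o j (by unfold starvedW; rw [card_starvedCol_of_isOPair o hcond]) c hc)
  · unfold starvedW at hc hc'
    rw [starvedCol_of_not o hcond] at hc hc'
    rcases Nat.lt_or_ge (starvedU o j).card 2 with hlt | hge
    · exact absurd (Finset.card_le_one.mp (by omega) c hc c' hc') hne
    · have hcard2 : (starvedU o j).card = 2 := le_antisymm (starvedU_card_le o j) hge
      have hx : ∃ x ∈ starvedU o j, (x : ℕ) ≤ o := by
        by_contra hall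
        push Not at hall
        exact hcond ⟨hcard2, hall⟩
      obtain ⟨x, hxU, hxo⟩ := hx
      obtain ⟨a, b, hab, hUab⟩ := Finset.card_eq_two.mp hcard2
      rw [hUab, Finset.mem_insert, Finset.mem_singleton] at hc hc' hxU
      rcases hc with rfl | rfl <;> rcases hc' with rfl | rfl
      · exact absurd rfl hne
      · rcases hxU with rfl | rfl
        · exact Or.inl hxo
        · exact Or.inr hxo
      · rcases hxU with rfl | rfl
        · exact Or.inr hxo
        · exact Or.inl hxo
      · exact absurd rfl hne

/-- The column map is injective on the rows. -/
theorem starvedW_injective : Function.Injective (starvedW o) := by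
  intro i j hij
  unfold starvedW at hij
  by_cases hi : IsOPair o (starvedU o i)
  · by_cases hj : IsOPair o (starvedU o j)
    · rw [starvedCol_of_isOPair o hi, starvedCol_of_isOPair o hj] at hij
      apply starvedU_injective o
      have hnot : ∀ U : Finset (Fin (2 * o + 1)), IsOPair o U → starvedApex o ∉ U.image (starvedShift o) := by
        intro U hU hmem
        obtain ⟨y, hy, hyo⟩ := Finset.mem_image.mp hmem
        have e1 := congrArg Fin.val hyo
        simp only [starvedShift, starvedApex] at e1
        have := hU.2 y hy; have := y.is_lt; omega
      have himg : (starvedU o i).image (starvedShift o) = (starvedU o j).image (starvedShift o) := by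
        have := congrArg (fun S => S.erase (starvedApex o)) hij
        simpa only [Finset.erase_insert (hnot _ hi), Finset.erase_insert (hnot _ hj)] using this
      have hrec : ∀ U V : Finset (Fin (2 * o + 1)), (∀ x ∈ U, o < (x : ℕ)) → (∀ x ∈ V, o < (x : ℕ)) →
          U.image (starvedShift o) = V.image (starvedShift o) → U ⊆ V := by
        intro U V hU hV hUV x hx
        have hmem : starvedShift o x ∈ V.image (starvedShift o) := hUV ▸ Finset.mem_image_of_mem _ hx
        obtain ⟨y, hy, hyx⟩ := Finset.mem_image.mp hmem
        have e1 := congrArg Fin.val hyx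
        simp only [starvedShift] at e1
        have := hU x hx
        have := hV y hy
        have hyx' : y = x := Fin.ext (by omega)
        rw [← hyx']
        exact hy
      exact Finset.Subset.antisymm (hrec _ _ hi.2 hj.2 himg) (hrec _ _ hj.2 hi.2 himg.symm)
    · exfalso
      have h3 := card_starvedCol_of_isOPair o hi
      rw [hij, starvedCol_of_not o hj] at h3
      have := starvedU_card_le o j
      omega
  · by_cases hj : IsOPair o (starvedU o j)
    · exfalso
      have h3 := card_starvedCol_of_isOPair o hj
      rw [← hij, starvedCol_of_not o hi] at h3
      have := starvedU_card_le o i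
      omega
    · rw [starvedCol_of_not o hi, starvedCol_of_not o hj] at hij
      exact starvedU_injective o hij

/-- The columns form a lower set (face-closed family). -/
theorem isLowerSet_starvedW : IsLowerSet (Set.range (starvedW o)) := by
  rintro W V hVW ⟨j, rfl⟩
  by_cases hVeq : V = starvedW o j
  · exact ⟨j, hVeq.symm⟩
  have hVlt : V.card < (starvedW o j).card := Finset.card_lt_card (lt_of_le_of_ne hVW hVeq)
  have hV2 : V.card ≤ 2 := by have := starvedW_card_le o j; omega
  obtain ⟨i, hi⟩ := starvedU_cover o V hV2
  refine ⟨i, ?_⟩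
  show starvedCol o (starvedU o i) = V
  rw [hi]
  apply starvedCol_of_not
  rintro ⟨hV2eq, hVO⟩
  by_cases hcond : IsOPair o (starvedU o j)
  · obtain ⟨x, hx⟩ : V.Nonempty := by rw [← Finset.card_pos]; omega
    have h1 := hVO x hx
    have h2 := le_of_mem_starvedW_three o j (by unfold starvedW; rw [card_starvedCol_of_isOPair o hcond]) x (hVW hx)
    omega
  · unfold starvedW at hVlt
    rw [starvedCol_of_not o hcond] at hVlt
    have := starvedU_card_le o j
    omega

/-! ## 4. Thickness -/

/-- `Σ_i |u i| ≥ 1 + 2·C(n,2)`, hence `n·n < Σ_i |u i| + n`. -/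
theorem starved_thick : (2 * o + 1) * (2 * o + 1) < (∑ i, (starvedU o i).card) + (2 * o + 1) := by
  classical
  have hsum_u : (∑ i, (starvedU o i).card) = ∑ U ∈ thinSets o, U.card := by
    have h1 : (∑ i, (starvedU o i).card) = ∑ x : thinSets o, (x : Finset (Fin (2 * o + 1))).card :=
      Fintype.sum_equiv (thinSets o).equivFin.symm (fun i => (starvedU o i).card)
        (fun x => (x : Finset (Fin (2 * o + 1))).card) (fun i => rfl)
    rw [h1, Finset.sum_coe_sort]
  have hsub : insert ({⟨0, by omega⟩} : Finset (Fin (2 * o + 1)))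
      (Finset.powersetCard 2 (Finset.univ : Finset (Fin (2 * o + 1)))) ⊆ thinSets o := by
    intro U hU
    rw [Finset.mem_insert] at hU
    unfold thinSets
    rw [Finset.mem_filter]
    refine ⟨Finset.mem_univ _, ?_⟩
    rcases hU with rfl | hU
    · rw [Finset.card_singleton]; omega
    · rw [(Finset.mem_powersetCard.mp hU).2]
  have hnotmem : ({⟨0, by omega⟩} : Finset (Fin (2 * o + 1))) ∉
      Finset.powersetCard 2 (Finset.univ : Finset (Fin (2 * o + 1))) := by
    intro hmem
    have := (Finset.mem_powersetCard.mp hmem).2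
    rw [Finset.card_singleton] at this
    omega
  have hbig : 1 + 2 * Nat.choose (2 * o + 1) 2 ≤ ∑ U ∈ thinSets o, U.card := by
    calc 1 + 2 * Nat.choose (2 * o + 1) 2
        = ∑ U ∈ insert ({⟨0, by omega⟩} : Finset (Fin (2 * o + 1)))
            (Finset.powersetCard 2 (Finset.univ : Finset (Fin (2 * o + 1)))), U.card := by
          rw [Finset.sum_insert hnotmem, Finset.card_singleton]
          congr 1
          rw [Finset.sum_const_nat (m := 2) (fun U hU => (Finset.mem_powersetCard.mp hU).2),
            Finset.card_powersetCard, Finset.card_univ, Fintype.card_fin, mul_comm]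
      _ ≤ ∑ U ∈ thinSets o, U.card := Finset.sum_le_sum_of_subset hsub
  rw [hsum_u]
  have := two_mul_choose_two_add o
  omega

/-- `Σ_i |u i| ≤ Σ_j |w j|` (so the columns are thick as well). -/
theorem sum_card_starvedU_le : (∑ i, (starvedU o i).card) ≤ ∑ j, (starvedW o j).card :=
  Finset.sum_le_sum fun i _ => card_le_card_starvedW o i

/-! ## 5. Dead for `n + n` forms -/

/-- **For `o ≥ 12` no product of `n + n` affine forms hits the killer layout** (`ChowStarve.no_chow_witness`). -/
theorem starved_dead (ho12 : 12 ≤ o)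
    (ℓ : Fin ((2 * o + 1) + (2 * o + 1)) → MvPolynomial (Fin ((2 * o + 1) + (2 * o + 1))) ℂ)
    (hℓ : ∀ k, (ℓ k).totalDegree ≤ 1) :
    (Matrix.of fun i j : Fin (starvedSize o) => coeff (∑ a ∈ starvedU o i, Finsupp.single (Fin.castAdd (2 * o + 1) a) 1 +
        ∑ c ∈ starvedW o j, Finsupp.single (Fin.natAdd (2 * o + 1) c) 1) (∏ k, ℓ k)).det = 0 :=
  no_chow_witness o (starvedU o) (starvedW o) (starvedU_injective o) (starvedU_cover o) (starvedW_card_le o)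
    (starvedW_noOPair o) (fun j h3 => le_of_mem_starvedW_three o j h3) (by omega)
    (three_mul_lt_choose o ho12) ℓ hℓ

end

end Summit.ValiantsHypothesis.ValiantsHypothesis.Theorems.BarrierLever.ChowStarvedPairs
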